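import Mathlib
import HarnessLib
import Literature.Analysis.FluidPDE.Tao2016AveragedNS.WeightedLatticeFlows
import Literature.Analysis.FluidPDE.Tao2016AveragedNS.ViscousLatticeFlows
import Literature.Analysis.FluidPDE.Tao2016AveragedNS.ViscousSmoothingBootstrap
import Literature.Analysis.FluidPDE.Tao2016AveragedNS.ViscousEnvelopeSmoothing

/-!
# Route `WakeRatchet`, crux `MinimalViscousBlowup` (stmt-NavierStokesRegularity-22743) — LINE g11-1 «threshold ray» (ns-idea-1 g11,
# skeleton v2.1 `threshold_ray_line_v21.lean` 31f30340cb446a3c), stub S1 `stub_largeNuRegular` PROVED (director-ns KEY-NS #177 (2a) / #195)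

`largeNuRegular` — binders VERBATIM the skeleton's `stub_largeNuRegular`: for every scale ratio `1+ε₀ > 1`, every table of the class `E₂(R)`
and every one-shell datum `X₀` there is `ν₂ > 0` such that the NS-scaled `ν`-viscous cascade lattice has a GLOBAL REGULAR solution from `X₀`
for every `ν ≥ ν₂` (the dissipation-dominated regime of Tao's viscous lattice; MODEL lattice ODEs only — nothing here is a statement about the
Navier–Stokes equations, about the crux, or about the rung `TaoLadderRungTwoBreak.Target`).

PROOF (LINE-g11-1.md §S1, with the tree's viscous-lattice toolkit).  Let `λ = 1+ε₀`, `A = 2Σ|X₀ᵢ| + 1`, `ν ≥ ν₂ := 32·m²·λ²·A` (`m = 4`, structure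
constants bounded by `1` after restriction to the shift set).
* `envelope_improve` (one bootstrap step): if a regular solution on `[0,t]` obeys the DOUBLED envelope `|X_{i,k}| ≤ 2Aλ^{−k}` on all shells, then it
  obeys `|X_{i,k}| ≤ Aλ^{−k}`: the three shells read by the nonlinearity are `≤ 2Aλ^{1−k}`, so `|quadTerm_{i,k}| ≤ 16m²A²λ^{k/2+2}`
  (`abs_quadTerm_le_of_bounds`); dividing by the dissipation rate `νλ^{2k}` (`abs_le_of_dissipative_forcing`) gives `≤ (A/2)λ^{−k}` for
  `ν ≥ ν₂`, and the datum contributes `≤ A/2` on shell `0` only.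
* `exists_tail_envelope` — the (4.5)-regular tail `k ≥ k₀(M)` obeys the envelope for free.
* `envelope_of_large_viscosity` — continuous induction in time (`IsClosed.Icc_subset_of_forall_mem_nhdsWithin`) on the finitely many shells
  `0 ≤ k < k₀`: the history set is closed (written with `min τ t`) and opens to the right by the strict improved bound and continuity.
* `largeNuRegular` — the envelope gives the subcritical tail-energy envelope `2A²(1−λ^{−2})^{−1}λ^{−2n}` (`η = 1`), uniformly on all windows, and
  `exists_viscousGlobal_of_subcriticalEnvelope_of_inTableClass` (BMR smoothing bootstrap + the continuation criterion
  `exists_viscousGlobal_of_apriori_bound`) returns the global regular solution.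

`--supports stmt-NavierStokesRegularity-22743 --as helper`.  ⟨22743⟩, ⟨20420⟩, TL-M2Break and NS regularity remain OPEN.
[cite: Tao2016AveragedNS, §4 (the viscous lattice before Thm. 4.2; Lemma 4.1 (4.5), (4.8)); BarbatoMorandinRomito2011, §3.1 Prop. 3.3]
-/

noncomputable section

-- the summit and its single sub-problem share the name (CONVENTIONS §1)
set_option linter.dupNamespace false

open Set Filter Topology Finset

namespace Summit.NavierStokesRegularity.NavierStokesRegularity.Theorems.MinimalViscousBlowup.ThresholdRay

open Literature.Analysis.FluidPDE Literature.Analysis.FluidPDE.TaoCascade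

variable {m : ℕ}

/-! ### §1 One bootstrap step: the doubled envelope improves to the envelope -/

/-- **One step of the dissipation bootstrap.**  Structure constants bounded by `M_α`, `λ = 1+ε₀ > 1`, `A > 0` with `|X₀ᵢ| ≤ A/2`, viscosity
`ν ≥ 32 m² M_α λ² A`.  If a solution of the `ν`-viscous lattice from the one-shell datum `X₀` (no shells below `0`) obeys the doubled envelope
`|X_{i,k}(τ)| ≤ 2Aλ^{−k}` for all shells on `[0,t]`, then it obeys `|X_{i,k}(τ)| ≤ Aλ^{−k}` there. [cite: BarbatoMorandinRomito2011, §3.1 Prop. 3.3] -/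
theorem envelope_improve {ε₀ ν Mα A : ℝ} (hε : 0 < ε₀) (hMα : 0 ≤ Mα) (hA : 0 < A)
    {α : Fin m → Fin m → Fin m → ℤ × ℤ × ℤ → ℝ} (hα : ∀ i₁ i₂ i₃ μ, |α i₁ i₂ i₃ μ| ≤ Mα)
    {X₀ : Fin m → ℝ} (hX₀ : ∀ i, |X₀ i| ≤ A / 2)
    (hν0 : 0 < ν) (hν : 32 * (m : ℝ) ^ 2 * Mα * (1 + ε₀) ^ (2 : ℝ) * A ≤ ν)
    {X : Fin m → ℤ → ℝ → ℝ} {t : ℝ}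
    (hinit : ∀ i k, X i k 0 = if k = 0 then X₀ i else 0)
    (hlow : ∀ i k, k < 0 → ∀ τ, X i k τ = 0)
    (hder : ∀ i k, ∀ τ ∈ Icc 0 t, HasDerivWithinAt (X i k)
        (quadTerm ε₀ α X i k τ - ν * (1 + ε₀) ^ ((2 : ℝ) * k) * X i k τ) (Icc 0 t) τ)
    (hyp : ∀ τ ∈ Icc 0 t, ∀ i k, |X i k τ| ≤ 2 * A * (1 + ε₀) ^ (-(k : ℝ))) :
    ∀ τ ∈ Icc 0 t, ∀ i k, |X i k τ| ≤ A * (1 + ε₀) ^ (-(k : ℝ)) := by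
  intro τ hτ i k
  have hl1 : (1 : ℝ) ≤ 1 + ε₀ := by linarith
  have hl0 : (0 : ℝ) < 1 + ε₀ := by linarith
  have hpow : ∀ a : ℝ, 0 < (1 + ε₀) ^ a := fun a => Real.rpow_pos_of_pos hl0 a
  rcases lt_or_ge k 0 with hk | hk
  · rw [hlow i k hk τ, abs_zero]
    exact mul_nonneg hA.le (hpow _).le
  · have hk' : (0 : ℝ) ≤ (k : ℝ) := by exact_mod_cast hk
    -- the three shells read by the nonlinearity are bounded by `b = 2A λ^{1-k}`
    set b : ℝ := 2 * A * (1 + ε₀) ^ (1 - (k : ℝ)) with hb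
    have hb0 : 0 ≤ b := by rw [hb]; exact mul_nonneg (by linarith) (hpow _).le
    have hbnd : ∀ σ ∈ Icc 0 t, ∀ (j : Fin m) (k' : ℤ), k - 1 ≤ k' → |X j k' σ| ≤ b := by
      intro σ hσ j k' hk'
      refine (hyp σ hσ j k').trans ?_
      rw [hb]
      refine mul_le_mul_of_nonneg_left (Real.rpow_le_rpow_of_exponent_le hl1 ?_) (by linarith)
      have : ((k : ℝ)) - 1 ≤ (k' : ℝ) := by exact_mod_cast (by linarith : k - 1 ≤ k')
      linarith
    -- bound on the nonlinearity
    set Q : ℝ := 16 * (m : ℝ) ^ 2 * Mα * A ^ 2 * (1 + ε₀) ^ ((k : ℝ) / 2 + 2) with hQ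
    have hq : ∀ σ ∈ Icc 0 t, |quadTerm ε₀ α X i k σ| ≤ Q := by
      intro σ hσ
      have h := abs_quadTerm_le_of_bounds hl0.le hMα hα X i k σ hb0 hb0
        (fun j => hbnd σ hσ j (k - 1) le_rfl) (fun j => hbnd σ hσ j k (by linarith))
        (fun j => hbnd σ hσ j (k + 1) (by linarith))
      refine h.trans ?_
      have h1 : (1 + ε₀) ^ ((5 : ℝ) * ((k : ℝ) - 1) / 2) ≤ (1 + ε₀) ^ ((5 : ℝ) * k / 2) :=
        Real.rpow_le_rpow_of_exponent_le hl1 (by linarith)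
      have hmain : (1 + ε₀) ^ ((5 : ℝ) * k / 2) * (b * b) = 4 * A ^ 2 * (1 + ε₀) ^ ((k : ℝ) / 2 + 2) := by
        rw [hb, show (k : ℝ) / 2 + 2 = (5 : ℝ) * k / 2 + ((1 - (k : ℝ)) + (1 - (k : ℝ))) by ring,
          Real.rpow_add hl0, Real.rpow_add hl0]
        ring
      have hmm : 0 ≤ (m : ℝ) ^ 2 * Mα := by positivity
      calc (m : ℝ) ^ 2 * Mα * ((1 + ε₀) ^ ((5 : ℝ) * k / 2) * (b * b + 2 * (b * b)) +
              (1 + ε₀) ^ ((5 : ℝ) * ((k : ℝ) - 1) / 2) * (b * b))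
          ≤ (m : ℝ) ^ 2 * Mα * ((1 + ε₀) ^ ((5 : ℝ) * k / 2) * (b * b + 2 * (b * b)) +
              (1 + ε₀) ^ ((5 : ℝ) * k / 2) * (b * b)) := by
            refine mul_le_mul_of_nonneg_left (add_le_add le_rfl ?_) hmm
            exact mul_le_mul_of_nonneg_right h1 (mul_nonneg hb0 hb0)
        _ = 4 * ((m : ℝ) ^ 2 * Mα) * ((1 + ε₀) ^ ((5 : ℝ) * k / 2) * (b * b)) := by ring
        _ = Q := by rw [hmain, hQ]; ring
    -- the dissipative Duhamel bound
    have hκ : 0 < ν * (1 + ε₀) ^ ((2 : ℝ) * k) := mul_pos hν0 (hpow _)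
    have hdiss := abs_le_of_dissipative_forcing hκ (hder i k) hq τ hτ
    -- forcing / dissipation ≤ (A/2) λ^{-k}
    have hQκ : Q / (ν * (1 + ε₀) ^ ((2 : ℝ) * k)) ≤ A / 2 * (1 + ε₀) ^ (-(k : ℝ)) := by
      rw [div_le_iff₀ hκ]
      have e1 : (1 + ε₀) ^ ((k : ℝ) / 2 + 2) ≤
          (1 + ε₀) ^ (2 : ℝ) * ((1 + ε₀) ^ (-(k : ℝ)) * (1 + ε₀) ^ ((2 : ℝ) * k)) := by
        rw [← Real.rpow_add hl0, ← Real.rpow_add hl0]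
        exact Real.rpow_le_rpow_of_exponent_le hl1 (by linarith)
      have e2 : 0 ≤ A * ((1 + ε₀) ^ (-(k : ℝ)) * (1 + ε₀) ^ ((2 : ℝ) * k)) :=
        mul_nonneg hA.le (mul_nonneg (hpow _).le (hpow _).le)
      calc Q = 16 * (m : ℝ) ^ 2 * Mα * A ^ 2 * (1 + ε₀) ^ ((k : ℝ) / 2 + 2) := hQ
        _ ≤ 16 * (m : ℝ) ^ 2 * Mα * A ^ 2 *
              ((1 + ε₀) ^ (2 : ℝ) * ((1 + ε₀) ^ (-(k : ℝ)) * (1 + ε₀) ^ ((2 : ℝ) * k))) :=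
            mul_le_mul_of_nonneg_left e1 (by positivity)
        _ = (32 * (m : ℝ) ^ 2 * Mα * (1 + ε₀) ^ (2 : ℝ) * A) *
              (A * ((1 + ε₀) ^ (-(k : ℝ)) * (1 + ε₀) ^ ((2 : ℝ) * k))) / 2 := by ring
        _ ≤ ν * (A * ((1 + ε₀) ^ (-(k : ℝ)) * (1 + ε₀) ^ ((2 : ℝ) * k))) / 2 := by
            gcongr
        _ = A / 2 * (1 + ε₀) ^ (-(k : ℝ)) * (ν * (1 + ε₀) ^ ((2 : ℝ) * k)) := by ring
    -- the datum
    by_cases hk0 : k = 0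
    · subst hk0
      have h00 : |X i 0 0| ≤ A / 2 := by rw [hinit, if_pos rfl]; exact hX₀ i
      have hz : (1 + ε₀) ^ (-((0 : ℤ) : ℝ)) = 1 := by simp
      rw [hz] at hQκ ⊢
      linarith [hdiss, h00, hQκ]
    · have h00 : |X i k 0| = 0 := by rw [hinit, if_neg hk0, abs_zero]
      rw [h00, zero_add] at hdiss
      have hAk : A / 2 * (1 + ε₀) ^ (-(k : ℝ)) ≤ A * (1 + ε₀) ^ (-(k : ℝ)) := by
        have := (hpow (-(k : ℝ))).le
        nlinarith
      exact hdiss.trans (hQκ.trans hAk)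

/-! ### §2 The regular tail obeys the envelope -/

/-- **The (4.5)-regular tail is envelope-dominated**: if `(1 + λ^{10k})|X_{i,k}(τ)| ≤ M` for all `τ, i, k`, then `|X_{i,k}(τ)| ≤ Aλ^{−k}` for all
`k ≥ k₀ = k₀(M, A, λ)`. [folklore] -/
theorem exists_tail_envelope {ε₀ A M : ℝ} (hε : 0 < ε₀) (hA : 0 < A) {X : Fin m → ℤ → ℝ → ℝ}
    (hM : ∀ (τ : ℝ) (i : Fin m) (k : ℤ), (1 + (1 + ε₀) ^ ((10 : ℝ) * k)) * |X i k τ| ≤ M) :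
    ∃ k₀ : ℕ, ∀ (τ : ℝ) (i : Fin m) (k : ℤ), (k₀ : ℤ) ≤ k → |X i k τ| ≤ A * (1 + ε₀) ^ (-(k : ℝ)) := by
  have hl1 : (1 : ℝ) < 1 + ε₀ := by linarith
  have hl0 : (0 : ℝ) < 1 + ε₀ := by linarith
  have h9 : (1 : ℝ) < (1 + ε₀) ^ (9 : ℝ) := Real.one_lt_rpow hl1 (by norm_num)
  obtain ⟨k₀, hk₀⟩ := pow_unbounded_of_one_lt (M / A) h9
  refine ⟨k₀, fun τ i k hk => ?_⟩
  have hpow : ∀ a : ℝ, 0 < (1 + ε₀) ^ a := fun a => Real.rpow_pos_of_pos hl0 a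
  have h1 := hM τ i k
  -- `λ^{10k} |X| ≤ M`
  have h2 : (1 + ε₀) ^ ((10 : ℝ) * k) * |X i k τ| ≤ M := by
    have : (1 + ε₀) ^ ((10 : ℝ) * k) * |X i k τ| ≤ (1 + (1 + ε₀) ^ ((10 : ℝ) * k)) * |X i k τ| :=
      mul_le_mul_of_nonneg_right (by linarith) (abs_nonneg _)
    exact this.trans h1
  -- `M ≤ A λ^{9k}`
  have h3 : M ≤ A * (1 + ε₀) ^ ((9 : ℝ) * k) := by
    have hMA : M < A * ((1 + ε₀) ^ (9 : ℝ)) ^ k₀ := by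
      have := hk₀
      rwa [div_lt_iff₀ hA, mul_comm] at this
    have h4 : ((1 + ε₀) ^ (9 : ℝ)) ^ k₀ = (1 + ε₀) ^ ((9 : ℝ) * (k₀ : ℝ)) := by
      rw [← Real.rpow_natCast, ← Real.rpow_mul hl0.le]
    have h5 : (1 + ε₀) ^ ((9 : ℝ) * (k₀ : ℝ)) ≤ (1 + ε₀) ^ ((9 : ℝ) * k) := by
      refine Real.rpow_le_rpow_of_exponent_le hl1.le ?_
      have : ((k₀ : ℤ) : ℝ) ≤ (k : ℝ) := by exact_mod_cast hk
      have hk0' : ((k₀ : ℤ) : ℝ) = (k₀ : ℝ) := by norm_cast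
      nlinarith
    rw [h4] at hMA
    exact hMA.le.trans (mul_le_mul_of_nonneg_left h5 hA.le)
  -- combine: `λ^{10k} |X| ≤ A λ^{9k}` ⇒ `|X| ≤ A λ^{-k}`
  have h6 : (1 + ε₀) ^ ((10 : ℝ) * k) = (1 + ε₀) ^ ((9 : ℝ) * k) * (1 + ε₀) ^ (k : ℝ) := by
    rw [← Real.rpow_add hl0]; ring_nf
  have h7 : (1 + ε₀) ^ (k : ℝ) * |X i k τ| ≤ A := by
    have h8 : (1 + ε₀) ^ ((9 : ℝ) * k) * ((1 + ε₀) ^ (k : ℝ) * |X i k τ|) ≤ (1 + ε₀) ^ ((9 : ℝ) * k) * A := by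
      rw [← mul_assoc, ← h6, mul_comm _ A]
      exact h2.trans h3
    exact le_of_mul_le_mul_left h8 (hpow _)
  have h9' : (1 + ε₀) ^ (-(k : ℝ)) = ((1 + ε₀) ^ (k : ℝ))⁻¹ := Real.rpow_neg hl0.le _
  rw [h9', ← div_eq_mul_inv, le_div_iff₀ (hpow _), mul_comm]
  exact h7

/-! ### §3 The envelope by continuous induction on the low shells -/

/-- **The large-viscosity envelope.**  Structure constants bounded by `M_α`, `λ = 1+ε₀ > 1`, `A > 0` with `|X₀ᵢ| ≤ A/2`, `ν ≥ 32 m² M_α λ² A`.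
Every regular solution of the `ν`-viscous lattice from the one-shell datum `X₀` on a window `[0,s]` (continuous components, no shells below `0`,
(4.5)-weighted bound finite, the viscous motion within `[0,s]`) obeys `|X_{i,k}(t)| ≤ Aλ^{−k}` on `[0,s]` — continuous induction in time on the
doubled envelope over the finitely many shells below the regular tail. [cite: BarbatoMorandinRomito2011, §3.1 Prop. 3.3; Tao2016AveragedNS, §4 Lemma 4.1 (4.5)] -/
theorem envelope_of_large_viscosity {ε₀ ν Mα A : ℝ} (hε : 0 < ε₀) (hMα : 0 ≤ Mα) (hA : 0 < A)
    {α : Fin m → Fin m → Fin m → ℤ × ℤ × ℤ → ℝ} (hα : ∀ i₁ i₂ i₃ μ, |α i₁ i₂ i₃ μ| ≤ Mα)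
    {X₀ : Fin m → ℝ} (hX₀ : ∀ i, |X₀ i| ≤ A / 2)
    (hν0 : 0 < ν) (hν : 32 * (m : ℝ) ^ 2 * Mα * (1 + ε₀) ^ (2 : ℝ) * A ≤ ν)
    {s : ℝ} {X : Fin m → ℤ → ℝ → ℝ}
    (hinit : ∀ i k, X i k 0 = if k = 0 then X₀ i else 0)
    (hlow : ∀ i k, k < 0 → ∀ τ, X i k τ = 0)
    (hreg : ∃ M : ℝ, ∀ (τ : ℝ) (i : Fin m) (k : ℤ), (1 + (1 + ε₀) ^ ((10 : ℝ) * k)) * |X i k τ| ≤ M)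
    (hcont : ∀ i k, Continuous (X i k))
    (hder : ∀ i k, ∀ τ ∈ Icc 0 s, HasDerivWithinAt (X i k)
        (quadTerm ε₀ α X i k τ - ν * (1 + ε₀) ^ ((2 : ℝ) * k) * X i k τ) (Icc 0 s) τ) :
    ∀ t ∈ Icc 0 s, ∀ i k, |X i k t| ≤ A * (1 + ε₀) ^ (-(k : ℝ)) := by
  have hl0 : (0 : ℝ) < 1 + ε₀ := by linarith
  have hpow : ∀ a : ℝ, 0 < (1 + ε₀) ^ a := fun a => Real.rpow_pos_of_pos hl0 a
  obtain ⟨M, hM⟩ := hreg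
  obtain ⟨k₀, htail⟩ := exists_tail_envelope (m := m) hε hA hM
  -- the history set of the doubled envelope on the low shells
  set H : Set ℝ := {t | ∀ τ ∈ Icc 0 t, ∀ (i : Fin m) (k : ℤ), 0 ≤ k → k < k₀ →
    |X i k τ| ≤ 2 * A * (1 + ε₀) ^ (-(k : ℝ))} with hH
  -- from the history set: the doubled envelope on all shells
  have hall : ∀ t, t ∈ H → ∀ τ ∈ Icc 0 t, ∀ i k, |X i k τ| ≤ 2 * A * (1 + ε₀) ^ (-(k : ℝ)) := by
    intro t ht τ hτ i k
    rcases lt_or_ge k 0 with hk | hk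
    · rw [hlow i k hk τ, abs_zero]
      exact mul_nonneg (by linarith) (hpow _).le
    · by_cases hk' : k < k₀
      · exact ht τ hτ i k hk hk'
      · refine (htail τ i k (not_lt.1 hk')).trans ?_
        have := (hpow (-(k : ℝ))).le
        nlinarith
  -- hence the improved envelope on `[0,t]` for `t ∈ H ∩ [0,s]`
  have himp : ∀ t ∈ Icc 0 s, t ∈ H → ∀ τ ∈ Icc 0 t, ∀ i k, |X i k τ| ≤ A * (1 + ε₀) ^ (-(k : ℝ)) := by
    intro t ht hH'
    refine envelope_improve hε hMα hA hα hX₀ hν0 hν hinit hlow (fun i k τ hτ => ?_) (hall t hH')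
    exact (hder i k τ ⟨hτ.1, hτ.2.trans ht.2⟩).mono (Icc_subset_Icc_right ht.2)
  -- `0 ∈ H`
  have h0 : (0 : ℝ) ∈ H := by
    intro τ hτ i k hk _
    have hτ0 : τ = 0 := le_antisymm hτ.2 hτ.1
    subst hτ0
    rw [hinit]
    split_ifs with hk0
    · subst hk0
      have : (1 + ε₀) ^ (-((0 : ℤ) : ℝ)) = 1 := by simp
      rw [this]
      linarith [hX₀ i, hA]
    · rw [abs_zero]
      exact mul_nonneg (by linarith) (hpow _).le
  -- the history set is closed in `[0,s]`
  have hclosed : IsClosed (H ∩ Icc 0 s) := by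
    have heq : H ∩ Icc 0 s = Icc 0 s ∩ ⋂ τ ∈ Icc (0 : ℝ) s, ⋂ (i : Fin m), ⋂ (k : ℤ),
        {t : ℝ | 0 ≤ k → k < k₀ → |X i k (min τ t)| ≤ 2 * A * (1 + ε₀) ^ (-(k : ℝ))} := by
      ext t
      simp only [hH, mem_inter_iff, mem_iInter, mem_setOf_eq]
      constructor
      · rintro ⟨ht, hts⟩
        exact ⟨hts, fun τ hτ i k hk hk' => ht (min τ t) ⟨le_min hτ.1 hts.1, min_le_right _ _⟩ i k hk hk'⟩
      · rintro ⟨hts, h⟩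
        refine ⟨fun τ hτ i k hk hk' => ?_, hts⟩
        have := h τ ⟨hτ.1, hτ.2.trans hts.2⟩ i k hk hk'
        rwa [min_eq_left hτ.2] at this
    rw [heq]
    refine isClosed_Icc.inter (isClosed_biInter fun τ _ => isClosed_iInter fun i => isClosed_iInter fun k => ?_)
    by_cases hk : 0 ≤ k ∧ k < k₀
    · have : {t : ℝ | 0 ≤ k → k < k₀ → |X i k (min τ t)| ≤ 2 * A * (1 + ε₀) ^ (-(k : ℝ))} =
          {t : ℝ | |X i k (min τ t)| ≤ 2 * A * (1 + ε₀) ^ (-(k : ℝ))} := by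
        ext t
        simp only [mem_setOf_eq]
        exact ⟨fun h => h hk.1 hk.2, fun h _ _ => h⟩
      rw [this]
      exact isClosed_le (continuous_abs.comp ((hcont i k).comp (continuous_const.min continuous_id)))
        continuous_const
    · have : {t : ℝ | 0 ≤ k → k < k₀ → |X i k (min τ t)| ≤ 2 * A * (1 + ε₀) ^ (-(k : ℝ))} = univ := by
        ext t
        simp only [mem_setOf_eq, mem_univ, iff_true]
        exact fun h1 h2 => absurd ⟨h1, h2⟩ hk
      rw [this]
      exact isClosed_univ
  -- the history set opens to the right: strict improved bound + continuity on finitely many shells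
  have hstep : ∀ x ∈ H ∩ Ico (0 : ℝ) s, H ∈ 𝓝[>] x := by
    rintro x ⟨hxH, hx⟩
    have himpx := himp x ⟨hx.1, hx.2.le⟩ hxH
    have hev : ∀ᶠ y in 𝓝 x, ∀ (i : Fin m), ∀ k ∈ Finset.Ico (0 : ℤ) k₀,
        |X i k y| < 2 * A * (1 + ε₀) ^ (-(k : ℝ)) := by
      refine eventually_all.2 fun i => (eventually_all_finset _).2 fun k _ => ?_
      have hlt : |X i k x| < 2 * A * (1 + ε₀) ^ (-(k : ℝ)) := by
        refine lt_of_le_of_lt (himpx x ⟨hx.1, le_rfl⟩ i k) ?_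
        have := hpow (-(k : ℝ))
        nlinarith
      exact ((continuous_abs.comp (hcont i k)).continuousAt).eventually_lt continuousAt_const hlt
    obtain ⟨δ, hδ, hball⟩ := Metric.eventually_nhds_iff.1 hev
    have hsub : Ioo x (x + δ) ⊆ H := by
      intro y hy τ hτ i k hk hk'
      rcases le_or_gt τ x with hτx | hτx
      · exact hxH τ ⟨hτ.1, hτx⟩ i k hk hk'
      · have hd : dist τ x < δ := by
          rw [Real.dist_eq, abs_of_pos (by linarith)]
          linarith [hτ.2, hy.2]
        exact (hball hd i k (Finset.mem_Ico.2 ⟨hk, hk'⟩)).le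
    exact mem_of_superset (Ioo_mem_nhdsGT (by linarith : x < x + δ)) hsub
  -- continuous induction
  have hIcc : Icc 0 s ⊆ H := hclosed.Icc_subset_of_forall_mem_nhdsWithin h0 hstep
  intro t ht i k
  exact himp t ht (hIcc ht) t ⟨ht.1, le_rfl⟩ i k

/-! ### §4 S1: large viscosity ⇒ a global regular solution -/

/-- **S1 `stub_largeNuRegular` (LINE g11-1 v2.1, binders VERBATIM) — THE DISSIPATION-DOMINATED REGIME.**  For every `ε₀ > 0`, every table of the
class `E₂(R)` and every one-shell datum there is `ν₂ > 0` such that the NS-scaled `ν`-viscous cascade lattice has a global regular solution from the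
datum for every `ν ≥ ν₂`: the envelope `Aλ^{−k}` of `envelope_of_large_viscosity` bounds the tail energies by `2A²(1−λ^{−2})^{−1}λ^{−2n}`
(subcritical, `η = 1`) uniformly on all windows, and `exists_viscousGlobal_of_subcriticalEnvelope_of_inTableClass` concludes.  MODEL lattice only.
[cite: Tao2016AveragedNS, §4 (viscous lattice before Thm. 4.2); BarbatoMorandinRomito2011, §3.2] -/
theorem largeNuRegular : ∀ ε₀ : ℝ, 0 < ε₀ → ∀ R : ℝ, 1 ≤ R →
    ∀ (α : Fin 4 → Fin 4 → Fin 4 → ℤ × ℤ × ℤ → ℝ) (X₀ : Fin 4 → ℝ),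
    Literature.Analysis.FluidPDE.TaoCascade.InTableClass R α →
    ∃ ν₂ : ℝ, 0 < ν₂ ∧ ∀ ν : ℝ, ν₂ ≤ ν →
      ∃ X : Fin 4 → ℤ → ℝ → ℝ, Literature.Analysis.FluidPDE.TaoCascade.ViscousGlobal ε₀ ν α X₀ X := by
  intro ε₀ hε R _hR α X₀ hα
  have hl0 : (0 : ℝ) < 1 + ε₀ := by linarith
  have hl1 : (1 : ℝ) < 1 + ε₀ := by linarith
  have hpow : ∀ a : ℝ, 0 < (1 + ε₀) ^ a := fun a => Real.rpow_pos_of_pos hl0 a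
  -- the envelope constant and the viscosity threshold
  set A : ℝ := 2 * ∑ i, |X₀ i| + 1 with hAdef
  have hsum : 0 ≤ ∑ i, |X₀ i| := Finset.sum_nonneg fun i _ => abs_nonneg _
  have hA : 0 < A := by rw [hAdef]; linarith
  have hX₀ : ∀ i, |X₀ i| ≤ A / 2 := fun i => by
    have := Finset.single_le_sum (fun j _ => abs_nonneg (X₀ j)) (Finset.mem_univ i)
    rw [hAdef]
    linarith
  set ν₂ : ℝ := 32 * ((4 : ℕ) : ℝ) ^ 2 * 1 * (1 + ε₀) ^ (2 : ℝ) * A with hν₂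
  have hν₂0 : 0 < ν₂ := by rw [hν₂]; positivity
  refine ⟨ν₂, hν₂0, fun ν hν => ?_⟩
  have hν0 : 0 < ν := lt_of_lt_of_le hν₂0 hν
  -- the restricted table is bounded by `1` and drives the same nonlinearity
  have hα' : ∀ i₁ i₂ i₃ μ, |restrictShiftSet α i₁ i₂ i₃ μ| ≤ 1 :=
    abs_restrictShiftSet_le zero_le_one (abs_le_one_of_inTableClass hα)
  -- the geometric ratio of the tail energies
  set r : ℝ := ((1 + ε₀) ^ (2 : ℕ))⁻¹ with hr
  have hr0 : 0 ≤ r := by rw [hr]; positivity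
  have hr1 : r < 1 := by
    rw [hr]
    exact inv_lt_one_of_one_lt₀ (one_lt_pow₀ hl1 two_ne_zero)
  have hrpow : ∀ k : ℕ, (A * (1 + ε₀) ^ (-((k : ℤ) : ℝ))) ^ 2 = A ^ 2 * r ^ k := by
    intro k
    have h1 : (1 + ε₀) ^ (-((k : ℤ) : ℝ)) = ((1 + ε₀) ^ k)⁻¹ := by
      rw [show (((k : ℤ) : ℝ)) = (k : ℝ) by norm_cast, Real.rpow_neg hl0.le, Real.rpow_natCast]
    rw [h1, hr, mul_pow, inv_pow, inv_pow, ← pow_mul, ← pow_mul, mul_comm 2 k]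
  have hrn : ∀ n : ℕ, r ^ n = (1 + ε₀) ^ (-((1 + 1) * (n : ℝ))) := by
    intro n
    rw [hr, inv_pow, ← pow_mul, Real.rpow_neg hl0.le, show (1 + 1) * (n : ℝ) = ((2 * n : ℕ) : ℝ) by push_cast; ring,
      Real.rpow_natCast]
  refine exists_viscousGlobal_of_subcriticalEnvelope_of_inTableClass hε.le one_pos hν0 hα X₀ (η := 1) fun T _hT => ?_
  refine ⟨2 * A ^ 2 / (1 - r), fun s hs X hinit hlow hreg hcont hder n N _hnN t ht => ?_⟩
  -- the envelope for this solution on `[0,s]`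
  have hder' : ∀ i k, ∀ τ ∈ Icc 0 s, HasDerivWithinAt (X i k)
      (quadTerm ε₀ (restrictShiftSet α) X i k τ - ν * (1 + ε₀) ^ ((2 : ℝ) * k) * X i k τ) (Icc 0 s) τ := by
    intro i k τ hτ
    rw [quadTerm_restrictShiftSet]
    exact hder i k τ hτ
  have hν' : 32 * ((4 : ℕ) : ℝ) ^ 2 * 1 * (1 + ε₀) ^ (2 : ℝ) * A ≤ ν := hν
  have henv := envelope_of_large_viscosity (m := 4) hε zero_le_one hA hα' hX₀ hν0 hν' hinit hlow hreg hcont hder' t ht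
  -- tail energies
  have hterm : ∀ k ∈ Finset.Icc n N, ∑ i, (1 / 2 : ℝ) * X i (k : ℤ) t ^ 2 ≤ 2 * A ^ 2 * r ^ k := by
    intro k _
    have hk : ∀ i, (1 / 2 : ℝ) * X i (k : ℤ) t ^ 2 ≤ (1 / 2) * (A ^ 2 * r ^ k) := by
      intro i
      refine mul_le_mul_of_nonneg_left ?_ (by norm_num)
      rw [← hrpow k, ← sq_abs]
      exact pow_le_pow_left₀ (abs_nonneg _) (henv i k) 2
    calc ∑ i, (1 / 2 : ℝ) * X i (k : ℤ) t ^ 2 ≤ ∑ _i : Fin 4, (1 / 2) * (A ^ 2 * r ^ k) := Finset.sum_le_sum fun i _ => hk i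
      _ = 2 * A ^ 2 * r ^ k := by simp; ring
  have hgeom : ∑ k ∈ Finset.Icc n N, r ^ k ≤ r ^ n / (1 - r) := by
    calc ∑ k ∈ Finset.Icc n N, r ^ k ≤ ∑ k ∈ Finset.Ico n (N + 1), r ^ k := by
          refine Finset.sum_le_sum_of_subset_of_nonneg (fun k hk => ?_) fun k _ _ => pow_nonneg hr0 k
          simp only [Finset.mem_Icc] at hk
          simp only [Finset.mem_Ico]
          omega
      _ ≤ r ^ n / (1 - r) := geom_sum_Ico_le_of_lt_one hr0 hr1
  calc ∑ k ∈ Finset.Icc n N, ∑ i, (1 / 2 : ℝ) * X i (k : ℤ) t ^ 2 ≤ ∑ k ∈ Finset.Icc n N, 2 * A ^ 2 * r ^ k :=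
        Finset.sum_le_sum hterm
    _ = 2 * A ^ 2 * ∑ k ∈ Finset.Icc n N, r ^ k := by rw [Finset.mul_sum]
    _ ≤ 2 * A ^ 2 * (r ^ n / (1 - r)) := mul_le_mul_of_nonneg_left hgeom (by positivity)
    _ = 2 * A ^ 2 / (1 - r) * (1 + ε₀) ^ (-((1 + 1) * (n : ℝ))) := by rw [← hrn n]; ring

/-- Alias under the skeleton's stub name (LINE g11-1 v2.1 `stub_largeNuRegular`). [folklore] -/
theorem stub_largeNuRegular : ∀ ε₀ : ℝ, 0 < ε₀ → ∀ R : ℝ, 1 ≤ R →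
    ∀ (α : Fin 4 → Fin 4 → Fin 4 → ℤ × ℤ × ℤ → ℝ) (X₀ : Fin 4 → ℝ),
    Literature.Analysis.FluidPDE.TaoCascade.InTableClass R α →
    ∃ ν₂ : ℝ, 0 < ν₂ ∧ ∀ ν : ℝ, ν₂ ≤ ν →
      ∃ X : Fin 4 → ℤ → ℝ → ℝ, Literature.Analysis.FluidPDE.TaoCascade.ViscousGlobal ε₀ ν α X₀ X :=
  largeNuRegular

end Summit.NavierStokesRegularity.NavierStokesRegularity.Theorems.MinimalViscousBlowup.ThresholdRay

end
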